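import Mathlib
import HarnessLib
import Literature.AlgebraicGeometry.Resolution.BlowupPrincipalCharts
import Summits.ResolutionOfSingularities.ResolutionOfSingularities.Theorems.WildQuotientsWildQuotientResolutionS1aVeroneseDegree

/-!
# S1a — R4e bricks for the glued level-2 centre: units on blow-up charts off the support, supports vs. filtration sections, homogeneous units

[OURS · L1 W4.5c · lead-1 g17; plan-1 RULING R-F15s ★ R4e-rational `graphTail_killsIn_two`, SPEC §1/§2 (disjoint supports of the point roots; the closed
set `B` of the multi-chart gluing; degree-0 associates of the member generators)] — NOT statements of the manuscript; counted 0; AI-level work, weaker than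
expert review. Crux stmt-ResolutionOfSingularities-17941 `CyclicQuotientFourfolds`, line `s1a-logminvertex` v13 (`stub_reachLowerInFX`).

* `mem_basicOpen_appLE_of_mem_blowupChart_of_not_mem_support` — on the principal chart `X′[U, g]`, at a point lying over the complement of `supp I`, the
  pulled-back generator `π^*g` is invertible;
* `ReesFiltration.not_mem_basicOpen_of_mem_support` — a section of a positive piece `(𝒦|W)_n` vanishes on `supp 𝒦_d ∩ W` (`0 < d`);
* `CoarseChart.exists_inv_mem_of_isUnit` — the inverse of a homogeneous unit of degree `θ` is homogeneous of degree `−θ`.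
-/

set_option linter.dupNamespace false

noncomputable section

universe u

open CategoryTheory Limits AlgebraicGeometry TopologicalSpace Topology Opposite
open Literature.AlgebraicGeometry.Resolution

namespace Literature.AlgebraicGeometry.Resolution

/-- **On the principal chart `X′[U, g]`, `π^*g` is invertible at every point lying over the complement of `supp I`** (there `I·𝒪 = (π^*g)` is the unit
ideal). [OURS · L1 W4.5c · R4e; folklore] -/
theorem mem_basicOpen_appLE_of_mem_blowupChart_of_not_mem_support {X' X : Scheme.{u}} (π : X' ⟶ X) (I : X.IdealSheafData) (U : X.affineOpens)
    (g : Γ(X, U)) {v : X'} (hv : v ∈ blowupChart π I U g) (hvs : π.base v ∉ (I.support : Set X)) {W : X'.Opens} (hW : W ≤ π ⁻¹ᵁ (U : X.Opens))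
    (hvW : v ∈ W) : v ∈ X'.basicOpen (π.appLE U W hW g) := by
  obtain ⟨W₀, ⟨h₀, -, hI⟩, hvW₀⟩ := mem_blowupChart_iff.mp hv
  have hns : v ∉ ((I.comap π).support : Set X') := by
    rw [Scheme.IdealSheafData.support_comap]; exact hvs
  have hz : ¬ v ∈ X'.zeroLocus (U := W₀.1) ((I.comap π).ideal W₀ : Set Γ(X', W₀)) := fun hz =>
    hns ((Scheme.IdealSheafData.mem_support_iff_of_mem (I := I.comap π) (U := W₀) hvW₀).mpr hz)
  rw [hI] at hz
  simp only [Scheme.mem_zeroLocus_iff, SetLike.mem_coe, not_forall, not_not] at hz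
  obtain ⟨f, hf, hvf⟩ := hz
  obtain ⟨c, rfl⟩ := Ideal.mem_span_singleton'.mp hf
  have hv₀ : v ∈ X'.basicOpen (π.appLE U W₀ h₀ g) := by
    rw [Scheme.basicOpen_mul] at hvf; exact hvf.2
  -- both sections are restrictions of `π^*g` on `π⁻¹U`
  have h1 : v ∈ X'.basicOpen (π.appLE U (π ⁻¹ᵁ (U : X.Opens)) le_rfl g) := by
    rw [← map_appLE_eq (le_rfl : π ⁻¹ᵁ (U : X.Opens) ≤ _) h₀ g, Scheme.basicOpen_res] at hv₀
    exact hv₀.2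
  rw [← map_appLE_eq (le_rfl : π ⁻¹ᵁ (U : X.Opens) ≤ _) hW g, Scheme.basicOpen_res]
  exact ⟨hvW, h1⟩

/-- **A section of a positive piece `(𝒦|W)_n` vanishes on `supp 𝒦_d ∩ W`** (`0 < d`, `0 < n`: the supports of all positive pieces coincide). [OURS · L1 W4.5c; folklore] -/
theorem ReesFiltration.not_mem_basicOpen_of_mem_support {V : Scheme.{u}} (𝒦 : ReesFiltration V) {d n : ℕ} (hd : 0 < d) (hn : 0 < n)
    (W : V.affineOpens) (t : Γ(V, W)) (ht : t ∈ (𝒦.filtration W).ideal n) {v : V} (hv : v ∈ ((𝒦.ideal d).support : Set V)) (hvW : v ∈ W.1) :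
    v ∉ V.basicOpen t := by
  rw [Summit.ResolutionOfSingularities.ResolutionOfSingularities.Theorems.WildQuotientResolution.S1.support_ideal_eq_of_pos 𝒦 hd hn] at hv
  have hz := (Scheme.IdealSheafData.mem_support_iff_of_mem (I := 𝒦.ideal n) (U := W) hvW).mp hv
  exact (Scheme.mem_zeroLocus_iff _ _ _).mp hz t ht

end Literature.AlgebraicGeometry.Resolution

namespace Summit.ResolutionOfSingularities.ResolutionOfSingularities.Theorems.WildQuotientResolution.S1.CoarseChart

open DirectSum

/-- **The inverse of a homogeneous unit of degree `θ` is homogeneous of degree `−θ`.** [folklore] -/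
theorem exists_inv_mem_of_isUnit {ι : Type*} [AddCommGroup ι] [DecidableEq ι] {B : Type*} [CommRing B] (𝒜 : ι → AddSubgroup B) [GradedRing 𝒜]
    {θ : ι} {u : B} (hu : u ∈ 𝒜 θ) (h : IsUnit u) : ∃ v ∈ 𝒜 (-θ), u * v = 1 := by
  obtain ⟨v, hv⟩ := h.exists_right_inv
  refine ⟨(decompose 𝒜 v (-θ) : B), (decompose 𝒜 v (-θ)).2, ?_⟩
  have h1 : (decompose 𝒜 (u * v) (θ + -θ) : B) = u * (decompose 𝒜 v (-θ) : B) := coe_decompose_mul_add_of_left_mem 𝒜 hu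
  rw [← h1, add_neg_cancel, hv, decompose_of_mem_same 𝒜 (SetLike.GradedOne.one_mem)]

/-- Powers of the homogeneous inverse: `u ^ n * v ^ n = 1` and `v ^ n ∈ 𝒜 (−(n • θ))`. [folklore] -/
theorem exists_inv_pow_mem_of_isUnit {ι : Type*} [AddCommGroup ι] [DecidableEq ι] {B : Type*} [CommRing B] (𝒜 : ι → AddSubgroup B) [GradedRing 𝒜]
    {θ : ι} {u : B} (hu : u ∈ 𝒜 θ) (h : IsUnit u) (n : ℕ) : ∃ v ∈ 𝒜 (-(n • θ)), u ^ n * v = 1 ∧ IsUnit v := by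
  obtain ⟨v, hv, huv⟩ := exists_inv_mem_of_isUnit 𝒜 hu h
  refine ⟨v ^ n, ?_, by rw [← mul_pow, huv, one_pow], (IsUnit.of_mul_eq_one _ (by rw [mul_comm, huv] : v * u = 1)).pow n⟩
  rw [← smul_neg]
  exact SetLike.pow_mem_graded n hv

end Summit.ResolutionOfSingularities.ResolutionOfSingularities.Theorems.WildQuotientResolution.S1.CoarseChart

end
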